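import Literature.MathematicalPhysics.QuantumFieldTheory.Balaban1983to89.T4TreeGaugeFixing
import Literature.MathematicalPhysics.QuantumFieldTheory.Balaban1983to89.TorusGeometry

/-!
# Lane `pub-balaban3d` — carrier layer p1 (`Carriers.RadialForest`): the radial (axial) forest `δ_{Ax(Ω)}` of the blocks over a set of
# coarse sites — the bond set of the contours `Γ_{y,x}` of [Balaban1984PropagatorsI] (1.7) p. 18 in the tree's centred convention — with
# an explicit peeling certificate (`T4AxialGaugeFixing.TreeOrder`) whose fresh ends avoid the block centres

Source: [Balaban1985UV3] (9) p. 258 «δ_{Ax(y)}(U) = Π_{x∈B(y),x≠y} δ(U(Γ_{y,x}))» (render `…-p004-x2.png`); [Balaban1984PropagatorsI] (1.7)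
p. 18 (render `…/1984-cmp95-propagators-rt-I/…-p002-x2.png`): from `y` move first along the last coordinate, then the preceding ones.
[folklore] lattice combinatorics; nothing of CMP 102 is asserted.  Consumed by `Carriers.Formula10` ((10) p. 258) and
`Carriers.RadialContour` (the holonomies `U(Γ_{y,x})`).
-/

open Finset

namespace Summit.QuantumFields.Balaban3D.Carriers

open Literature.MathematicalPhysics.QuantumFieldTheory.Balaban1983to89
open Literature.MathematicalPhysics.QuantumFieldTheory.Balaban1983to89.T4AxialGaugeFixing (TreeOrder)

/-! ## §2 The radial (axial) forest `δ_{Ax(Ω)}` of a set of blocks, with its peeling certificate -/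

section Radial

variable {P : Params} {j : ℕ}

/-- The OFFSET of a fine site inside its block along the coordinate `κ`: the label of `x_κ` modulo `L` (blocks are the `L`
consecutive labels `nL, …, nL + L − 1`, `Setup.blockOf`; the centre `emb y` has offset `(L − 1)/2` in every coordinate). [folklore] -/
def off (x : Site P j) (κ : Fin P.d) : ℕ := (x κ).val % P.L

/-- THE RADIAL FOREST of the blocks over `Ω ⊂ T^{(j+1)}`: the bonds `⟨z, z + e_μ⟩` with both endpoints in one block `B(y)`,
`y ∈ Ω`, whose coordinates BELOW `μ` sit at the block centre.  These are exactly the bonds of the contours `Γ_{y,x}`, `x ∈ B(y)`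
([Balaban1984PropagatorsI] (1.7) p. 18: from the centre move first along the last coordinate, then the preceding ones; centred
blocks, cell pub-balaban DIVERGENCE F3), so that «`U(Γ_{y,x}) = 1` for all `x ∈ B(y), x ≠ y`» — the support of `δ_{Ax(y)}` in
[Balaban1985UV3] (9) p. 258 — is «`U = 1` on the radial forest of `B(y)`».  (The contour system itself is not an object of the
tree vocabulary, DIVERGENCE F6; this Finset is its bond set.) [cite: Balaban1985UV3, (9) p.258] -/
def radialBonds (Ω : Finset (Site P (j+1))) : Finset (PBond P j) :=
  Finset.univ.filter fun b =>
    blockOf b.src ∈ Ω ∧ off b.src b.dir < P.L - 1 ∧ ∀ κ, κ < b.dir → off b.src κ = (P.L - 1) / 2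

/-- The FRESH END of a radial bond: its endpoint farther from the block centre (the point `x` reached last along `Γ_{y,x}`). [folklore] -/
def radialFresh (b : PBond P j) : Site P j := if (P.L - 1) / 2 ≤ off b.src b.dir then b.tgt else b.src

/-- The RANK of a fine site: its taxicab distance to the centre of its block, in lattice units. [folklore] -/
def radialRank (x : Site P j) : ℕ := ∑ κ, Nat.dist (off x κ) ((P.L - 1) / 2)

/-- Membership in the radial forest — bookkeeping. [folklore] -/
theorem mem_radialBonds {Ω : Finset (Site P (j+1))} {b : PBond P j} :
    b ∈ radialBonds Ω ↔ blockOf b.src ∈ Ω ∧ off b.src b.dir < P.L - 1 ∧ ∀ κ, κ < b.dir → off b.src κ = (P.L - 1) / 2 := by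
  simp [radialBonds]

/-- The radial forest is monotone in `Ω`. [folklore] -/
theorem radialBonds_mono {Ω Ω' : Finset (Site P (j+1))} (h : Ω ⊆ Ω') : radialBonds Ω ⊆ radialBonds (Ω' : Finset (Site P (j+1))) :=
  fun b hb => by
    rw [mem_radialBonds] at hb ⊢
    exact ⟨h hb.1, hb.2⟩

/-- Offsets are `< L`. [folklore] -/
theorem off_lt (x : Site P j) (κ : Fin P.d) : off x κ < P.L := Nat.mod_lt _ P.L_pos

/-- `x + e_μ` agrees with `x` off the coordinate `μ`. [folklore] -/
theorem shift_apply_ne (x : Site P j) {μ κ : Fin P.d} (h : κ ≠ μ) : (x.shift μ) κ = x κ := by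
  simp [Site.shift, Function.update_of_ne h]

/-- `(x + e_μ)_μ = x_μ + 1` in `ZMod`. [folklore] -/
theorem shift_apply_self (x : Site P j) (μ : Fin P.d) : (x.shift μ) μ = x μ + 1 := by
  simp [Site.shift]

/-- `x ↦ x + e_μ` is injective. [folklore] -/
theorem shift_injective (μ : Fin P.d) : Function.Injective (fun x : Site P j => x.shift μ) := by
  intro x x' h
  funext κ
  by_cases hκ : κ = μ
  · subst hκ
    have := congrFun h κ
    simpa [Site.shift] using this
  · have := congrFun h κ
    simpa [Site.shift, Function.update_of_ne hκ] using this

/-- Away from the far face of the block (`offset < L − 1`) the label does not wrap: `label(x_μ) + 1 < sitesPerDir j`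
(standing range). [folklore] -/
theorem val_succ_lt (hj : j + 1 ≤ P.m + P.K) (x : Site P j) (μ : Fin P.d) (hs : off x μ < P.L - 1) :
    (x μ).val + 1 < P.sitesPerDir j := by
  have hN : P.sitesPerDir j = P.sitesPerDir (j+1) * P.L := P.sitesPerDir_eq_mul_succ hj
  have hlt : (x μ).val < P.sitesPerDir j := ZMod.val_lt _
  have hq : (x μ).val / P.L < P.sitesPerDir (j+1) := by
    rw [Nat.div_lt_iff_lt_mul P.L_pos, ← hN]; exact hlt
  have hdm := Nat.div_add_mod ((x μ).val) P.L
  have h1 : P.L * ((x μ).val / P.L + 1) ≤ P.L * P.sitesPerDir (j+1) := Nat.mul_le_mul_left _ hq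
  rw [mul_add, mul_one] at h1
  have h2 : P.L * P.sitesPerDir (j+1) = P.sitesPerDir j := by rw [hN, mul_comm]
  have hL := P.hL.2
  unfold off at hs
  omega

/-- `label((x + e_μ)_μ) = label(x_μ) + 1` away from the far face (standing range). [folklore] -/
theorem val_shift_self (hj : j + 1 ≤ P.m + P.K) (x : Site P j) (μ : Fin P.d) (hs : off x μ < P.L - 1) :
    ((x.shift μ) μ).val = (x μ).val + 1 := by
  have h := val_succ_lt hj x μ hs
  rw [shift_apply_self, ZMod.val_add_of_lt (by rw [ZMod.val_one]; exact h), ZMod.val_one]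

/-- Offset of `x + e_μ` along `μ` is one more (away from the far face; standing range). [folklore] -/
theorem off_shift_self (hj : j + 1 ≤ P.m + P.K) (x : Site P j) (μ : Fin P.d) (hs : off x μ < P.L - 1) :
    off (x.shift μ) μ = off x μ + 1 := by
  unfold off at hs ⊢
  have hL := P.hL.2
  rw [val_shift_self hj x μ hs, Nat.add_mod, Nat.one_mod_eq_one.mpr (by omega),
    Nat.mod_eq_of_lt (a := (x μ).val % P.L + 1) (by omega)]

/-- Offsets of `x + e_μ` off `μ` are unchanged. [folklore] -/
theorem off_shift_ne (x : Site P j) {μ κ : Fin P.d} (h : κ ≠ μ) : off (x.shift μ) κ = off x κ := by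
  unfold off; rw [shift_apply_ne x h]

/-- `x + e_μ` lies in the same block as `x` away from the far face (standing range). [folklore] -/
theorem blockOf_shift (hj : j + 1 ≤ P.m + P.K) (x : Site P j) (μ : Fin P.d) (hs : off x μ < P.L - 1) :
    blockOf (x.shift μ) = blockOf x := by
  funext κ
  by_cases hκ : κ = μ
  · subst hκ
    show (((((x.shift κ) κ).val / P.L : ℕ)) : ZMod (P.sitesPerDir (j+1))) = (((x κ).val / P.L : ℕ) : ZMod _)
    rw [val_shift_self hj x κ hs]
    have hdm := Nat.div_add_mod ((x κ).val) P.L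
    unfold off at hs
    have hL := P.hL.2
    have this : (x κ).val + 1 = P.L * ((x κ).val / P.L) + ((x κ).val % P.L + 1) := by omega
    have hlt : (x κ).val % P.L + 1 < P.L := by omega
    rw [this, Nat.mul_add_div P.L_pos, Nat.div_eq_of_lt hlt, add_zero]
  · show (((((x.shift μ) κ).val / P.L : ℕ)) : ZMod (P.sitesPerDir (j+1))) = (((x κ).val / P.L : ℕ) : ZMod _)
    rw [shift_apply_ne x hκ]

/-- The centre of a block has offset `(L − 1)/2` in every coordinate (standing range). [folklore] -/
theorem off_emb (hj : j + 1 ≤ P.m + P.K) (y : Site P (j+1)) (κ : Fin P.d) : off (emb y) κ = (P.L - 1) / 2 := by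
  unfold off
  rw [Site.val_emb hj y κ, Nat.mul_comm, Nat.mul_add_mod, Nat.mod_eq_of_lt (by have := P.hL.2; omega)]

/-- The fresh end is an endpoint — bookkeeping. [folklore] -/
theorem radialFresh_eq (b : PBond P j) : radialFresh b = b.src ∨ radialFresh b = b.tgt := by
  unfold radialFresh; split_ifs <;> simp

/-- Offsets of the fresh end of a radial bond: at the centre below the bond's direction, OFF the centre in the bond's direction,
and beyond the centre there exactly when the fresh end is the target. [folklore] -/
theorem off_radialFresh (hj : j + 1 ≤ P.m + P.K) {Ω : Finset (Site P (j+1))} {b : PBond P j} (hb : b ∈ radialBonds Ω) :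
    (∀ κ, κ < b.dir → off (radialFresh b) κ = (P.L - 1) / 2) ∧ off (radialFresh b) b.dir ≠ (P.L - 1) / 2 ∧
      ((P.L - 1) / 2 < off (radialFresh b) b.dir ↔ (P.L - 1) / 2 ≤ off b.src b.dir) := by
  obtain ⟨_, hs, hlow⟩ := mem_radialBonds.1 hb
  by_cases hc : (P.L - 1) / 2 ≤ off b.src b.dir
  · have hv : radialFresh b = b.src.shift b.dir := by simp [radialFresh, hc, PBond.tgt]
    rw [hv]
    refine ⟨fun κ hκ => ?_, ?_, ?_⟩
    · rw [off_shift_ne _ (ne_of_lt hκ)]; exact hlow κ hκ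
    · rw [off_shift_self hj _ _ hs]; omega
    · rw [off_shift_self hj _ _ hs]; constructor <;> intro <;> omega
  · have hv : radialFresh b = b.src := by simp [radialFresh, hc]
    rw [hv]
    refine ⟨hlow, by omega, ?_⟩
    constructor <;> intro <;> omega

/-- THE PEELING CERTIFICATE of the radial forest: fresh end = the endpoint farther from the centre, rank = taxicab distance to the
centre (standing range `j + 1 ≤ m + K`).  Hence the 4D cell's tree-gauge theorem applies to `δ_{Ax(Ω)}`. [folklore] -/
theorem treeOrder_radialBonds (hj : j + 1 ≤ P.m + P.K) (Ω : Finset (Site P (j+1))) :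
    TreeOrder (radialBonds Ω) (radialFresh (P := P) (j := j)) radialRank where
  endpoint b _ := radialFresh_eq b
  ne b hb := by
    obtain ⟨_, hs, _⟩ := mem_radialBonds.1 hb
    intro h
    have := congrArg (fun x : Site P j => off x b.dir) h
    simp only [PBond.tgt] at this
    rw [off_shift_self hj _ _ hs] at this
    omega
  inj b hb b' hb' h := by
    have F := off_radialFresh hj hb
    have F' := off_radialFresh hj hb'
    rw [h] at F
    -- the directions agree
    have hdir : b.dir = b'.dir := by
      rcases lt_trichotomy b.dir b'.dir with hlt | heq | hgt
      · exact absurd (F'.1 _ hlt) F.2.1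
      · exact heq
      · exact absurd (F.1 _ hgt) F'.2.1
    -- the sources agree
    obtain ⟨_, hs, _⟩ := mem_radialBonds.1 hb
    obtain ⟨_, hs', _⟩ := mem_radialBonds.1 hb'
    have hsrc : b.src = b'.src := by
      by_cases hc : (P.L - 1) / 2 < off (radialFresh b') b'.dir
      · -- both fresh ends are targets
        have h1 : (P.L - 1) / 2 ≤ off b.src b.dir := F.2.2.1 (hdir ▸ hc)
        have h2 : (P.L - 1) / 2 ≤ off b'.src b'.dir := F'.2.2.1 hc
        have e1 : radialFresh b = b.src.shift b.dir := by simp [radialFresh, h1, PBond.tgt]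
        have e2 : radialFresh b' = b'.src.shift b'.dir := by simp [radialFresh, h2, PBond.tgt]
        rw [e1, e2, hdir] at h
        exact shift_injective _ h
      · -- both fresh ends are sources
        have h1 : ¬ (P.L - 1) / 2 ≤ off b.src b.dir := fun h1 => hc (hdir ▸ F.2.2.2 h1)
        have h2 : ¬ (P.L - 1) / 2 ≤ off b'.src b'.dir := fun h2 => hc (F'.2.2.2 h2)
        have e1 : radialFresh b = b.src := by simp [radialFresh, h1]
        have e2 : radialFresh b' = b'.src := by simp [radialFresh, h2]
        rw [e1, e2] at h
        exact h
    cases b; cases b'; simp_all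
  rank b hb := by
    obtain ⟨_, hs, _⟩ := mem_radialBonds.1 hb
    -- the rank of the target differs from the rank of the source only in the coordinate `b.dir`
    have hsplit : ∀ x : Site P j, radialRank x
        = Nat.dist (off x b.dir) ((P.L - 1) / 2) + ∑ κ ∈ Finset.univ.erase b.dir, Nat.dist (off x κ) ((P.L - 1) / 2) :=
      fun x => (Finset.add_sum_erase _ _ (Finset.mem_univ b.dir)).symm
    have htgt : ∑ κ ∈ Finset.univ.erase b.dir, Nat.dist (off b.tgt κ) ((P.L - 1) / 2)
        = ∑ κ ∈ Finset.univ.erase b.dir, Nat.dist (off b.src κ) ((P.L - 1) / 2) := by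
      refine Finset.sum_congr rfl fun κ hκ => ?_
      rw [PBond.tgt, off_shift_ne _ (Finset.ne_of_mem_erase hκ)]
    have hoff : off b.tgt b.dir = off b.src b.dir + 1 := by rw [PBond.tgt, off_shift_self hj _ _ hs]
    by_cases hc : (P.L - 1) / 2 ≤ off b.src b.dir
    · have hv : radialFresh b = b.tgt := by simp [radialFresh, hc]
      left
      rw [hv, hsplit b.src, hsplit b.tgt, htgt, hoff]
      have : Nat.dist (off b.src b.dir) ((P.L - 1) / 2) < Nat.dist (off b.src b.dir + 1) ((P.L - 1) / 2) := by
        rw [Nat.dist_eq_sub_of_le_right hc, Nat.dist_eq_sub_of_le_right (by omega)]; omega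
      omega
    · have hv : radialFresh b = b.src := by simp [radialFresh, hc]
      right
      rw [hv, hsplit b.src, hsplit b.tgt, htgt, hoff]
      have : Nat.dist (off b.src b.dir + 1) ((P.L - 1) / 2) < Nat.dist (off b.src b.dir) ((P.L - 1) / 2) := by
        rw [Nat.dist_eq_sub_of_le (by omega), Nat.dist_eq_sub_of_le (by omega)]; omega
      omega

/-- FRESH ENDS AVOID THE CENTRES: «u(y) = 1 for y ∈ T^{(1)}» is respected — the one-site transformations the peeling uses never
sit at a coarse site `emb y` (standing range). [folklore] -/
theorem emb_ne_radialFresh (hj : j + 1 ≤ P.m + P.K) {Ω : Finset (Site P (j+1))} {b : PBond P j}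
    (hb : b ∈ radialBonds Ω) (y : Site P (j+1)) : emb y ≠ radialFresh b := by
  intro h
  have := (off_radialFresh hj hb).2.1
  rw [← h, off_emb hj] at this
  exact this rfl

end Radial


end Summit.QuantumFields.Balaban3D.Carriers
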